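import Literature.NumberTheory.EllipticCurves.PNewBranchFrobeniusGaloisLattice
import HarnessLib

/-!
# The `p`-new ordinary branch through `f_E`: Castella's two-variable BDP function read on an analytic chart WITH
# `ℚ_p`-RATIONAL MEMBERS — the named fact T-An-2ʳ (= T-An-2 ∧ (rat) on the SAME chart; NO Galois clause)

Literature module (types a source; D-0014 named fact = `def … : Prop` with a body, used as a hypothesis; no `sorry`, no
`axiom`, no instance, no notation). Cell `bsd-eis`, ideator lineage `bsd-idea-12` (g44), for crux 4 `BSDpOnCellC` of route
`EisensteinPrimes` (stmt-BirchSwinnertonDyer-19034), skeleton `telescope`.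

## What this module is for (host g38 conditions (1)–(5), eis STATUS 2026-08-30 l.7171; director (610))

The registered skeleton v19 cites, as ONE assembled stub, the named fact T-An-2ᶠ
`hida1986_castella2020_exists_frobeniusGaloisLattice_on_pNewBranchChart` = [T-An-2 verbatim] ∧ [a framed continuous Galois
lattice `π : Γ_ℚ →ₜ* GL₂(ℤ_p⟦X⟧)` on the same chart with (F-unr), (F-fib₀), (F-fib_t), (F-rat)]. The three GALOIS clauses
(F-unr)/(F-fib₀)/(F-fib_t) — Hida 1986 Thm. 2.1 (2.2b)/(2.2c) — are to be DISCHARGED in the tree by A. Wiles's method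
([Wiles1988] §2.2: interpolate the traces of the members' Deligne representations along the chart into `ℤ_p⟦X⟧`, form the
pseudo-representation `{a, d, x}` with the complex conjugation, realise it by [Hida2000] Prop. 2.16, take the reflexive hull of
the resulting lattice — tree files `Literature.NumberTheory.GaloisRepresentations.WilesPseudoRep`,
`Summit.…Theorems.TelescopeBranchTraceInterpolation`, …). What such a construction must still be GIVEN is exactly T-An-2
AND the `ℚ_p`-rationality of the members (the fibre traces must be `ℤ_p`-valued): that conjunction, ON ONE AND THE SAME
chart `(A, x, D)`, is the present fact T-An-2ʳ. It is the PROJECTION of T-An-2ᶠ that forgets `π` and the three Galois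
clauses and keeps (F-rat) byte for byte (`rationalMembers_of_frobeniusGaloisLattice` below, proved), and it projects onto
T-An-2 (`twoVariableBDP_of_rationalMembers`, proved). Why a conjunction «T-An-2 ∧ (rat)» of two CLOSED propositions cannot
serve instead: (rat) speaks about the members `D t` of THE chart whose existence T-An-2 asserts — the existential must be
shared, so the conjunction lives under one `∃ (A x D)`; the only closed alternative, «every analytic chart through `f_E` has
`ℚ_p`-rational members», is a statement about ALL charts that no source prints (it would follow from the étaleness of the
branch at `f_E`, strong multiplicity one and rigidity of bounded power series, i.e. it is an assembled claim, not a
transcription) and is therefore NOT used.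

## Printed content and transcription

T-An-2 (Castella 2020 Def. 2.10/Thm. 2.11/Rem. 2.12 ∘ Castella 2018 Thm. 3.1, §4 (4.1) ∘ the chart of T-An-1): see
`castella2020_exists_twoVariableBDP_on_pNewBranchChart` (this fact repeats its binders and its body TOKEN FOR TOKEN).
(R-rat): [GreenbergStevens1993] §2 as recalled by [Venerucci2016], Introduction (arXiv:1407.1913 p0004 L56–63, the verbatim
sentence) and §2.4 (the construction of `𝓜`, `a_n(k) := 𝓜(a_n)`, `f_∞`) — «for every `k ∈ U ∩ ℤ^{≥2}`, the `q`-expansion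
`f_k := Σ a_n(k)qⁿ ∈ S_k(Γ₁(Np), ℤ_p)` is an `N`-new `p`-ordinary Hecke eigenform of weight `k`, and `f_2 = f`», i.e. the members of THE family through `f_E` have `ℤ_p`-rational `q`-expansions; the
underlying reason is [Hida1986] Cor. 1.3/1.4 (the branch `𝓘` is unramified over `Λ` at the point of `f_E`, whose residue field
is `ℚ_p` because `f_E` is `ℚ`-rational), whence `κ(P_t) ↪ 𝓘_{P_t}/P_t = ℚ_p` for the members near `f_E`: every Hecke
eigenvalue `a(ℓ, f_{P_t})` lies in `ℤ_p`; `f_{P_t}` is the ordinary `p`-stabilisation of the member newform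
`g_t ∈ S_{k_t}(Γ₀(N/p))` ((memb) of the chart), `a_p(g_t) = α + p^{k_t−1}/α` with `α ∈ ℤ_p^×`, so `K_{g_t} ↪ ℚ_p` under
`ι_t = ι⁻¹|_{K_{g_t}}`, i.e. `algebraMap ℤ_[p] (padicCoeffIntegers (D t).ι)` is onto — the SAME derivation (D6) as in the
sibling modules (flags `TG-rat`/`TU-rat`/`TF-rat`), where this clause is already a conjunct of the cited facts T-An-2ᵍ/ᴴ/ᶠ.
TRANSCRIPTION: under EXACTLY the binders of `hida1986_castella2020_exists_frobeniusGaloisLattice_on_pNewBranchChart` (token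
for token), THERE ARE chart data `(A, x, D)` with `IsPNewBranchAnalyticChart W p ι j A x D`, the CM periods and `L` of T-An-2
with (an∞), (an_t) VERBATIM, AND (R-rat). Nothing else: no Galois representation, no lattice, no `Ω`.

## Flags (for the referee / host typing pre-check)

* `TR-chain`: a conjunction of published results read on one chart (as T-An-2 itself: Castella ∘ GS93 ∘ Hida); the chart
  and (rat) come from the SAME source paragraph ([Venerucci2016] §2.4 ← [GreenbergStevens1993] §2).
* `TR-rat`: (R-rat) = (D6); a referee who doubts `κ(P_t) = ℚ_p` reads [Hida1986] Cor. 1.4 and [Venerucci2016] §2.4.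
* `TR-p3`: binder `2 < p` INHERITED from T-An-1/T-An-2 (flag `T1-p3`: [Hida1986] prints `p ≥ 5`; the `p = 3` étaleness /
  control is [Wiles1988] Thm. 2.2.2 / [Hida1993EMI] §7.3 as recorded in the T-An-1 module). This module adds NO `p = 3`
  content of its own: the Galois side, where [Wiles1988] Thm. 2.2.1 was the `p = 3` source of T-An-2ᶠ (hold TF-p3,
  acq-06039), is exactly what leaves the cited surface when T-An-2ᶠ is derived from T-An-2ʳ in the tree.
* D-0026 disclosure: +1 Literature module; the by-name count of the registered skeleton is UNCHANGED by this landing (nothing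
  registered cites it yet) and stays 28 → 28 if a future re-cut swaps `stub_assembledFactsF : T-An-2ᶠ` for a stub typed by
  this fact once the kernel bridge `T-An-2ʳ → T-An-2ᶠ` is a landed theorem (director (610), host conditions (1)–(5)).

HONEST LABEL: a definition with a body and two one-line projections; asserts nothing by itself; no `_holds`; BSD is proved
for no curve by this.
-/

noncomputable section

open scoped MatrixGroups ModularForm Topology

open CongruenceSubgroup NumberField IsDedekindDomain Field Filter UpperHalfPlane
  Literature.NumberTheory.GaloisRepresentations
  Literature.NumberTheory.EllipticCurves.ModularForms
  Literature.NumberTheory.EllipticCurves.GreenbergSelmer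

namespace Literature.NumberTheory.EllipticCurves

/-- **T-An-2ʳ (Castella 2020/2018 ∘ Greenberg–Stevens 1993 ∘ Hida 1986 Cor. 1.3/1.4) — the ordinary branch through the
`p`-NEW weight-2 newform `f_E` carries, ON ONE AND THE SAME analytic chart `(A, x, D)`, Castella's two-variable BDP function
(T-An-2, verbatim) AND `ℚ_p`-RATIONAL members.** TRANSCRIPTION: under EXACTLY the binders of
`hida1986_castella2020_exists_frobeniusGaloisLattice_on_pNewBranchChart` / `castella2020_exists_twoVariableBDP_on_pNewBranchChart`
(token for token), THERE ARE `(A, x, D)` with `IsPNewBranchAnalyticChart W p ι j A x D`, CM periods `Ω_K ≠ 0`, `Ω_p ∈ R₀ˣ` and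
`L ∈ R₀⟦X⟧⟦T⟧` with (an∞) and (an_t) VERBATIM, AND (R-rat) `ℤ_p → padicCoeffIntegers (D t).ι` onto for every `t` — the
projection of T-An-2ᶠ forgetting the Galois lattice (`rationalMembers_of_frobeniusGaloisLattice`), projecting onto T-An-2
(`twoVariableBDP_of_rationalMembers`). Flags `TR-chain`, `TR-rat`, `TR-p3`: module docstring. Named fact (D-0014); a
conjunction of published results; nothing constructed; no `_holds`; BSD is proved for no curve by this.
[cite: Castella2020JIMJ, §1.1, §1.2, Def. 2.10, Thm. 2.11, Rem. 2.12] [cite: Castella2018, §2, Thm. 3.1, §4 (4.1), p. 11]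
[cite: Castella2018Exceptional, Introduction and §3.2 Thm. 3.4] [cite: CastellaHsieh2018, §3.3 Def. 3.7 and Prop. 3.8]
[cite: GreenbergStevens1993, §2 (the family f_k ∈ S_k(Γ₁(Np), ℤ_p), f_2 = f, via Venerucci 2016 §2.4)]
[cite: Venerucci2016, Introduction (arXiv:1407.1913 p0004 L56–63: "f_k := Σ a_n(k)qⁿ ∈ S_k(Γ₁(Np), ℤ_p) … and f_2 = f"), §2.1 (p0007: "R is unramified over Λ at ν_f"), §2.4 (p0008 L155–p0009 L20: 𝓜, a_n(k) := 𝓜(a_n), f_∞ ∈ 𝒜_U⟦q⟧)]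
[cite: Hida1986, Thm. I, Cor. 1.3, Cor. 1.4, Cor. 1.5 (Invent. Math. 85, pp. 546, 554–556)] [cite: Delbourgo2008, §4.2 p. 92]
[cite: Skinner2016PacificMC, §2.6 (2-6-1)] -/
def hida1986_castella2020_exists_rationalMembers_on_pNewBranchChart : Prop :=
  ∀ {p : ℕ} [Fact p.Prime] (ι : PadicAlgCl p ≃+* ℂ) (W : WeierstrassCurve ℚ) [W.IsElliptic]
    [W.IsGloballyMinimal] (K : Type) [Field K] [NumberField K]
    (𝔭 : HeightOneSpectrum (𝓞 K)) (κ : ZpExtension K p) (γ : absoluteGaloisGroup K)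
    [Fact (κ.IsTopGenerator γ)] {N : ℕ} [NeZero N] {f : CuspForm (Gamma0 N) 2}
    (_ : IsNewformOf W f),
    -- `f = f_E` of level `N`, `p` an ODD prime with `p ∥ N` (tame level `M = N/p`, `f` `p`-stabilised-new and ordinary)
    W.conductorNorm ℤ = N → 2 < p → W.HasMultiplicativeReductionAtPrime p →
    -- `K` imaginary quadratic, `d_K` odd and `< −4`, every prime of `N = Mp` split in `K` (Heegner for `M`, and `p = 𝔭𝔭̄` split)
    IsImaginaryQuadratic K → Odd (NumberField.discr K) → NumberField.discr K < -4 →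
    SatisfiesHeegnerHypothesis N K →
    ((Ideal.span {(p : ℤ)}).primesOver (𝓞 K)).ncard = 2 →
    -- `𝔭` the prime above `p` induced by `ı_p = ι⁻¹`
    ((p : ℕ) : 𝓞 K) ∈ 𝔭.asIdeal →
    (∀ (w : InfinitePlace K) (y : 𝓞 K), y ∈ 𝔭.asIdeal ↔ ‖ι.symm (w.embedding (y : K))‖ < 1) →
    -- `Γ` THE anticyclotomic `ℤ_p`-extension (`γ` a topological generator, `1 + T ↔ γ`)
    κ.IsAnticyclotomic →
    -- the structure map `j : ℤ_p → R₀` of the chart (characterised by its values in `ℂ_p`)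
    ∀ (j : ℤ_[p] →+* unrIntegers p),
      (∀ z : ℤ_[p], ((j z : unrIntegers p) : ℂ_[p]) = algebraMap ℚ_[p] ℂ_[p] (z : ℚ_[p])) →
    ∃ (A : ℕ → UnrSeries p) (x : ℕ → ℤ_[p]) (D : ℕ → Skinner2016.HidaCongruentForm W p 1),
      -- the chart and the members [Hida86 / GS93: T-An-1's clauses]
      IsPNewBranchAnalyticChart W p ι j A x D ∧
      -- T-An-2 VERBATIM: CM periods and `L = L_p(𝐟)` read on the chart, with (an∞) and (an_t)
      (∃ (ΩK : ℂ) (Ωp : (unrIntegers p)ˣ) (L : PowerSeries (PowerSeries (unrIntegers p))),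
        ΩK ≠ 0 ∧
        -- (an∞) the weight-2 (`X = 0`, `p`-new) fibre generates the ideal of Castella's `L_p(f)` [Cas18 (4.1) at `𝐟_φ = f`, p. 11; Thm. 3.1]
        (∃ L₂ : UnrSeries p, IsBDPLFunction ι 𝔭 κ γ f ΩK ((Ωp : unrIntegers p) : ℂ_[p]) L₂ ∧
          Ideal.span {PowerSeries.map (PowerSeries.constantCoeff (R := unrIntegers p)) L} =
            Ideal.span {L₂}) ∧
        -- (an_t) the fibre at the member point `x_t` generates the ideal of the member's BDP function, SAME periods [Cas18 (4.1); Cas20 Thm. 2.11]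
        (∀ t : ℕ, ∃ (Ψ Lg : UnrSeries p),
          (∃ U : PowerSeries (PowerSeries (unrIntegers p)),
            PowerSeries.map (PowerSeries.C (R := unrIntegers p)) Ψ =
              L + PowerSeries.C (PowerSeries.X - PowerSeries.C (j (x t))) * U) ∧
          IsBDPLFunctionWt ι 𝔭 κ γ (D t).g ΩK ((Ωp : unrIntegers p) : ℂ_[p]) Lg ∧
          Ideal.span {Ψ} = Ideal.span {Lg})) ∧
      -- (R-rat) the members are `ℚ_p`-rational under `ι_t`: `ℤ_p → 𝒪_t` is onto — BYTE-IDENTICAL to (F-rat)/(U-rat)/(G-rat)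
      --         [GS93 §2 via Venerucci 2016 §2.4 «f_k ∈ S_k(Γ₁(Np), ℤ_p)»; Hida86 Cor. 1.3/1.4 at the étale point (D6)]
      (∀ t : ℕ, Function.Surjective (algebraMap ℤ_[p] (padicCoeffIntegers (D t).ι)))

/-! ### API (proved): the two projections -/

/-- T-An-2ʳ is the projection of T-An-2ᶠ: forget the Galois lattice, keep (F-rat) byte for byte (the logical projection of
[Hida1986] Thm. 2.1 ∧ Cor. 1.4 onto Cor. 1.4's rationality content). [cite: Hida1986, Cor. 1.4 and Thm. 2.1 (projection)] -/
theorem rationalMembers_of_frobeniusGaloisLattice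
    (h : hida1986_castella2020_exists_frobeniusGaloisLattice_on_pNewBranchChart) :
    hida1986_castella2020_exists_rationalMembers_on_pNewBranchChart := by
  unfold hida1986_castella2020_exists_rationalMembers_on_pNewBranchChart
  intro p _ ι W _ _ K _ _ 𝔭 κ γ _ N _ f hf hN hp hmult hK hodd hdisc hHeeg hsplit hp𝔭 h𝔭 hanti j hj
  obtain ⟨A, x, D, hchart, hL, π, hπ⟩ := h ι W K 𝔭 κ γ hf hN hp hmult hK hodd hdisc hHeeg hsplit hp𝔭 h𝔭 hanti j hj
  exact ⟨A, x, D, hchart, hL, hπ.2.2.2⟩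

/-- T-An-2ʳ projects onto T-An-2 (drop (R-rat)): Castella's statement is a conjunct. [cite: Castella2018, §4 (4.1) (projection)] -/
theorem twoVariableBDP_of_rationalMembers
    (h : hida1986_castella2020_exists_rationalMembers_on_pNewBranchChart) :
    castella2020_exists_twoVariableBDP_on_pNewBranchChart := by
  unfold castella2020_exists_twoVariableBDP_on_pNewBranchChart
  intro p _ ι W _ _ K _ _ 𝔭 κ γ _ N _ f hf hN hp hmult hK hodd hdisc hHeeg hsplit hp𝔭 h𝔭 hanti j hj
  obtain ⟨A, x, D, hchart, hL, -⟩ := h ι W K 𝔭 κ γ hf hN hp hmult hK hodd hdisc hHeeg hsplit hp𝔭 h𝔭 hanti j hj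
  exact ⟨A, x, D, hchart, hL⟩

end Literature.NumberTheory.EllipticCurves

end
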